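import Literature.MathematicalPhysics.QuantumFieldTheory.Balaban1983to89.B4CubeFields22
import Literature.MathematicalPhysics.QuantumFieldTheory.Balaban1983to89.B4Eq220CommutatorField

/-!
# [B4] p. 575: THE FIELD HYPOTHESES OF THE LEMMA-2.2 LINEAGE AT THE CUBE CONFIGURATION `Ã_j`, PROVED FROM (1.7), and
# the threshold «for e sufficiently small»; charge scaling `(κ, A) ↦ (1, κA)` of the lineage's operators
# [Balaban1983RegularityDecay]

statement-level skeleton of published theorems with citation tags; proofs where landed; nothing here is a claim about the Yang–Mills mass gap

CITATION HEADER.  T. Bałaban, *Regularity and decay of lattice Green's functions*, Commun. Math. Phys. **89** (1983)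
571–597, doi:10.1007/bf01214744 [Balaban1983RegularityDecay] (cell paper B4; held text
`paper:balaban1983-cmp89-regularity-decay`, journal page = PDF page + 570; pp. 572–573, 575, 577–579, 581).  PDF held:
yes.  Unit `lit-balaban-p35` gen 6 (Phase-2 proof seat), HOME `run/shared/lean/pub/lit-balaban/`.  WHAT IS REPRODUCED: SKELETON
rows **B4.Def§2** / **B4.Eq2.2** (the `Ã_j` of (2.2)) and the hypotheses of **B4.Lem2.2** at `Ã_j` («Ã … regular …
constant in a neighbourhood of the boundary of □», «for e sufficiently small»).  File 2 of 3 (file 1 `B4CubeFields22`: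
the construction and the sizes from (1.7); file 3 `B4Eq220CubeField`: the factor bounds (2.20)/(2.21)/c₁ at `Ã_j`).
Imports `B4CubeFields22` and `B4Eq220CommutatorField` (p35 gen 5; closure: the Lemma-2.2 lineage
`B4Lemma22ReduceZero.Box/opA/greenA/derivA`, `B4Eq220CommutatorField.kOp`).

WHAT IS PRINTED (p. 575, verbatim).  «… where the configurations Ã_j are constructed in the following way: if □_j
intersects the boundary of Ω, then Ã_j = A; if □_j is an interior cube of Ω, then we take Ã_j as equal to A on the cube
{x: |x − Mj| ≤ ¾M}, and changing regularly to a constant function in a neighbourhood of a boundary of □_j. For example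
using the regularity condition (1.4) [= (1.7)] we can write the configuration A on □_j as A = A₀ + A′, where A₀ is a
constant configuration, e.g. A₀ = A(Mj), and A′ is regular and small, i.e. |A′|, |∂^η_μA′| ≤ c′e^{β−1}, with c′
depending on c, d, and M, more exactly c′ = dMc. We take a function θ ∈ C₀^∞(]−1,1[), θ = 1 on [−¾,¾], and we define
θ_j(x) = Π_{μ=1}^d θ((x_μ − Mj_μ)/M), Ã_j = A₀ + θ_jA′. In the sequel we will use this definition of Ã_j. Of course it
satisfies the regularity condition (1.4) with another constant c.»; p. 573 (1.7): «|(∂^η_μA)(x)| ≤ ce^{β−1}, x ∈ Ω,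
μ = 1,…,d, β > 0».  p. 581: «For e sufficiently small the series is convergent».

WHAT THIS MODULE PROVES (all in full; no `sorry`, standard axioms).
* §4 CHARGE SCALING `(κ, A) ↦ (1, κA)`: `fieldLink_smul` (`U(κA_b) = U(1·(κA)_b)`), `opA_smul`, `greenA_smul`,
  `kOp_smul`, `derivA_smul`, `constBond_smul`, `smul_cubeField` (`κÃ_j = (κA₀) + κθ_jA′` in the lineage's `A₀ + A′`
  format).  Purpose: the constants of the Lemma-2.2 lineage are stated with the coupling `κ` quantified BEFORE `∃ c`;
  evaluating them at `κ = 1` on the field `κA` makes them available UNIFORMLY in the charge `e` and the mesh, as the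
  Theorem's «constants … independent of A, k, Ω» requires.
* §5 **`cubeField_hyps`** — for `□ = Π_μ[0, nM_μ)` with `M_μ ≤ S`, the cube of the label `j` inside
  (`K(j_μ + 1) ≤ M_μ`, `j_μ ≥ 1`), `nK ≥ 16`, and `A` (1.7)-regular on `□` with constants `c, β`: the scaled cut-off
  fluctuation `A′ := (e/n)·θ_jA′` satisfies EVERY field hypothesis of `B4Eq220FactorField` / `B4Eq218FirstFactor` /
  `B4Lemma22CrossSup.lemma22_17_sup_box` at coupling `1` — antisymmetry, `|A′_b| ≤ θ/n` with `θ = (d+1)S·c·e^β`,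
  `|A′(b′) − A′(b)| ≤ θ′/n²` with `θ′ = c·e^β(1 + D1(θ)(d+1)S/K)`, `A′ = 0` at the faces; **`cube_threshold`**
  (two multiples of `e^β` below any `t > 0` for `0 < e ≤ e₁`); **`smallness_of_le`** (the (1.8)-type and the
  Neumann-series smallness conditions of the lineage from `θ, θ′ ≤ t`, uniformly over `a_k ∈ [¾a₋, a₊]`);
  `aSeq_window` (`¾a₋ ≤ a_k ≤ a₊` for `L ≥ 2`); **`cubeField_threshold`** (the three combined: for `0 < e ≤ e₁`,
  `θ(e) ≤ 1` and both smallness conditions at `θ(e), θ′(e)` for every `a_k` of the window).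

HONEST SCOPE.  As file 1; the threshold `e₁` depends on `(d, flow Lipschitz constant, the Lemma-2.2 constant c, a-window,
regularity constants c, β, side bound S, cube size K)` — the print's «c′ = dMc» feeding «for e sufficiently small».
Theorems only; no `def`, no `Prop` fact, no `sorry`; axioms standard.
-/

namespace Literature.MathematicalPhysics.QuantumFieldTheory.Balaban1983to89.B4CubeFieldHyps22

open Finset Matrix
open Literature.MathematicalPhysics.QuantumFieldTheory.Balaban1983to89.B4GaugeCovariance
open Literature.MathematicalPhysics.QuantumFieldTheory.Balaban1983to89.B4Reflection242 (boxDom nbrs mem_boxDom mem_nbrs)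
open Literature.MathematicalPhysics.QuantumFieldTheory.Balaban1983to89.B4Lower18Regular (e1 e1_apply_self e1_apply_ne)
open Literature.MathematicalPhysics.QuantumFieldTheory.Balaban1983to89.B4Lemma22ReduceZero (Box opA greenA derivA)
open Literature.MathematicalPhysics.QuantumFieldTheory.Balaban1983to89.B4PartitionUnity22 (thetaProf D1 D1_nonneg
  contDiff_thetaProf hasCompactSupport_thetaProf)
open Literature.MathematicalPhysics.QuantumFieldTheory.Balaban1983to89.B4Eq220CommutatorField (kOp)
open Literature.MathematicalPhysics.QuantumFieldTheory.Balaban1983to89.B4CubeFields22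

noncomputable section

variable {d : ℕ}

/-! ## §4. Charge scaling `(κ, A) ↦ (1, κA)`: the lineage's constants are uniform in the coupling -/

section Scaling

variable {ι : Type} [Fintype ι] [DecidableEq ι]

/-- `U(κA_b) = U(1·(κA)_b)`: the link variables (1.2) «U(A) = e^{qeηA}» depend on the charge and the field only
through the product `eηA`. [cite: Balaban1983RegularityDecay, (1.2) p. 572] -/
theorem fieldLink_smul {X : Type*} (F : OrthFlow ι) (κ : ℝ) (A : X → X → ℝ) :
    fieldLink F κ A = fieldLink F 1 (fun u v => κ * A u v) := by
  funext u v
  simp only [fieldLink, one_mul]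

/-- `H(□, A)` at coupling `κ` is `H(□, κA)` at coupling `1`. [cite: Balaban1983RegularityDecay, (1.6) p. 572] -/
theorem opA_smul (F : OrthFlow ι) (κ : ℝ) (ℓ k : ℕ) (a m2 : ℝ) (M : Fin (d + 1) → ℕ)
    (emb : ↥(boxDom M) → ↥(Box d ℓ k M)) (Γ : ↥(boxDom M) → ↥(Box d ℓ k M) → List ↥(Box d ℓ k M))
    (A : ↥(Box d ℓ k M) → ↥(Box d ℓ k M) → ℝ) :
    opA d F κ ℓ k a m2 M emb Γ A = opA d F 1 ℓ k a m2 M emb Γ (fun u v => κ * A u v) := by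
  unfold opA b4Op
  rw [fieldLink_smul F κ A]

/-- `G_k(□, A)` at coupling `κ` is `G_k(□, κA)` at coupling `1`. [cite: Balaban1983RegularityDecay, (1.6) p. 572] -/
theorem greenA_smul (F : OrthFlow ι) (κ : ℝ) (ℓ k : ℕ) (a m2 : ℝ) (M : Fin (d + 1) → ℕ)
    (emb : ↥(boxDom M) → ↥(Box d ℓ k M)) (Γ : ↥(boxDom M) → ↥(Box d ℓ k M) → List ↥(Box d ℓ k M))
    (A : ↥(Box d ℓ k M) → ↥(Box d ℓ k M) → ℝ) :
    greenA d F κ ℓ k a m2 M emb Γ A = greenA d F 1 ℓ k a m2 M emb Γ (fun u v => κ * A u v) := by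
  unfold greenA b4Green b4Op
  rw [fieldLink_smul F κ A]

/-- `K_h = [h, H(□, A)]` at coupling `κ` is the commutator at coupling `1` and field `κA`.
[cite: Balaban1983RegularityDecay, (2.10) p. 576] -/
theorem kOp_smul (F : OrthFlow ι) (κ : ℝ) (n : ℕ) (a m2 : ℝ) (M : Fin (d + 1) → ℕ)
    (emb : ↥(boxDom M) → ↥(boxDom fun i => n * M i))
    (Γ : ↥(boxDom M) → ↥(boxDom fun i => n * M i) → List ↥(boxDom fun i => n * M i))
    (A : ↥(boxDom fun i => n * M i) → ↥(boxDom fun i => n * M i) → ℝ) (h : ↥(boxDom fun i => n * M i) → ℝ) :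
    kOp F κ n a m2 M emb Γ A h = kOp F 1 n a m2 M emb Γ (fun u v => κ * A u v) h := by
  unfold kOp
  rw [fieldLink_smul F κ A]

/-- `D^η_{A,μ}` at coupling `κ` is `D^η_{κA,μ}` at coupling `1`. [cite: Balaban1983RegularityDecay, (1.3) p. 572] -/
theorem derivA_smul (F : OrthFlow ι) (κ : ℝ) (ℓ k : ℕ) (M : Fin (d + 1) → ℕ)
    (A : ↥(Box d ℓ k M) → ↥(Box d ℓ k M) → ℝ) (μ : Fin (d + 1)) :
    derivA d F κ ℓ k M A μ = derivA d F 1 ℓ k M (fun u v => κ * A u v) μ := by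
  unfold derivA
  rw [fieldLink_smul F κ A]

/-- scaling a constant configuration: `κ·A₀(u,v) = (κA₀)(u,v)`.
[cite: Balaban1983RegularityDecay, p. 581 «constant configurations A₀», dictionary] -/
theorem constBond_smul {X : Type*} (κ : ℝ) (A₀ : Fin (d + 1) → ℝ) (pos : X → Fin (d + 1) → ℤ) (u v : X) :
    κ * constBond A₀ pos u v = constBond (fun μ => κ * A₀ μ) pos u v := by
  simp only [constBond, Finset.mul_sum]
  exact Finset.sum_congr rfl fun μ _ => by ring

/-- `κÃ_j = (κA₀) + κ·θ_jA′` — the scaled cube field in the `A₀ + A′` format of the Lemma-2.2 lineage.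
[cite: Balaban1983RegularityDecay, §2 p. 575] -/
theorem smul_cubeField {R : Finset (Fin (d + 1) → ℤ)} (κ : ℝ) (n K : ℕ) (j : Fin (d + 1) → ℤ)
    (A₀ : Fin (d + 1) → ℝ) (Ac : (Fin (d + 1) → ℤ) → Fin (d + 1) → ℝ) :
    (fun u v => κ * cubeField R n K j A₀ Ac u v)
      = constBond (fun μ => κ * A₀ μ) Subtype.val + fun u v => κ * cubeFluct R n K j A₀ Ac u v := by
  funext u v
  rw [Pi.add_apply, Pi.add_apply, cubeField_apply, mul_add, constBond_smul]

end Scaling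

/-! ## §5. The field hypotheses of the Lemma-2.2 lineage at `Ã_j`, from (1.7); the threshold «e sufficiently small» -/

section Hyps

/-- `e·e^{β−1} = e^β`. [folklore] -/
private theorem mul_rpow_sub_one {e : ℝ} (he : 0 < e) (β : ℝ) : e * e ^ (β - 1) = e ^ β := by
  rw [Real.rpow_sub_one he.ne', mul_div_cancel₀ _ he.ne']

/-- **THE FIELD HYPOTHESES OF THE LEMMA-2.2 LINEAGE AT `Ã_j`, PROVED FROM (1.7).**  Box `□ = Π_μ[0, nM_μ)`,
`n = L^k`, sides `M_μ ≤ S`, the cube of the label `j` inside (`K(j_μ + 1) ≤ M_μ`, `j_μ ≥ 1`), `nK ≥ 16`; the field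
`A` regular on `□` in the printed sense (1.7) with constants `c, β`; charge `e > 0`, coupling `κ = e/n`.  Then the
scaled cut-off fluctuation `A′ = (e/n)·θ_jA′` (so that `(e/n)Ã_j = (e/n)A₀ + A′`) is antisymmetric, has
`|A′_b| ≤ θ/n` on nearest-neighbour bonds with `θ = (d+1)S·c·e^β`, `|A′(b′) − A′(b)| ≤ θ′/n²` on consecutive parallel
bonds with `θ′ = c·e^β·(1 + D1(θ)(d+1)S/K)`, and vanishes on the bonds at the faces — verbatim the hypotheses
`hanti′/hA′/hder/hbd` of `B4Eq220FactorField`, `B4Eq218FirstFactor`, `B4Lemma22CrossSup` (at coupling `1`).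
[cite: Balaban1983RegularityDecay, §2 p. 575 «A′ is regular and small, i.e. |A′|, |∂^η_μA′| ≤ c′e^{β−1} … c′ = dMc»] -/
theorem cubeField_hyps {ℓ k : ℕ} (hn : 1 ≤ (ℓ + 1) ^ k) {M : Fin (d + 1) → ℕ} {S K : ℕ}
    (hS : ∀ i, M i ≤ S) (hK : 1 ≤ K) (hnK : 16 ≤ (ℓ + 1) ^ k * K) {j : Fin (d + 1) → ℤ} (hjlo : ∀ μ, 1 ≤ j μ)
    (hjhi : ∀ μ, (K : ℤ) * (j μ + 1) ≤ M μ) {Ac : (Fin (d + 1) → ℤ) → Fin (d + 1) → ℝ} {creg β e : ℝ}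
    (hcreg : 0 ≤ creg) (he : 0 < e)
    (h17 : ∀ x ∈ Box d ℓ k M, ∀ μ ν : Fin (d + 1),
      |Ac (x + e1 μ) ν - Ac x ν| ≤ creg * e ^ (β - 1) / ((ℓ + 1) ^ k : ℕ)) :
    let A' : ↥(Box d ℓ k M) → ↥(Box d ℓ k M) → ℝ :=
      fun u v => e / ((ℓ + 1) ^ k : ℕ) * cubeFluct (Box d ℓ k M) ((ℓ + 1) ^ k) K j (Ac 0) Ac u v
    (∀ x y, A' y x = -A' x y) ∧
    (∀ x y : ↥(Box d ℓ k M), y.1 ∈ nbrs x.1 →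
      |1 * A' x y| ≤ ((d : ℝ) + 1) * S * creg * e ^ β / ((ℓ + 1) ^ k : ℕ)) ∧
    (∀ (x z y : ↥(Box d ℓ k M)) (μ : Fin (d + 1)), z.1 = x.1 + e1 μ → y.1 = z.1 + e1 μ →
      |1 * (A' y z - A' z x)|
          ≤ creg * e ^ β * (1 + D1 thetaProf * (((d : ℝ) + 1) * S) / K) / (((ℓ + 1) ^ k : ℕ) : ℝ) ^ 2 ∧
      |1 * (A' x z - A' z y)|
          ≤ creg * e ^ β * (1 + D1 thetaProf * (((d : ℝ) + 1) * S) / K) / (((ℓ + 1) ^ k : ℕ) : ℝ) ^ 2) ∧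
    (∀ (x y : ↥(Box d ℓ k M)) (μ : Fin (d + 1)), y.1 = x.1 + e1 μ →
      (x.1 - e1 μ ∉ Box d ℓ k M ∨ y.1 + e1 μ ∉ Box d ℓ k M) → A' x y = 0 ∧ A' y x = 0) := by
  intro A'
  set n : ℕ := (ℓ + 1) ^ k with hn_def
  have hnr : (0 : ℝ) < n := by exact_mod_cast hn
  have hN : ∀ i, 1 ≤ n * M i := by
    intro i
    have h1 : (K : ℤ) * (j i + 1) ≤ M i := hjhi i
    have h2 : (1 : ℤ) ≤ j i := hjlo i
    have hK' : (1 : ℤ) ≤ K := by exact_mod_cast hK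
    have : (1 : ℤ) ≤ M i := by nlinarith
    have hMi : 1 ≤ M i := by exact_mod_cast this
    exact le_trans hn (Nat.le_mul_of_pos_right _ hMi)
  have hT : ∀ i, ((n * M i : ℕ) : ℤ) ≤ (n : ℤ) * S := fun i => by
    push_cast; exact mul_le_mul_of_nonneg_left (by exact_mod_cast hS i) (by positivity)
  have hδ : 0 ≤ creg * e ^ (β - 1) / (n : ℕ) := by positivity
  have hjhi' : ∀ μ, (n : ℤ) * K * (j μ + 1) ≤ ((n * M μ : ℕ) : ℤ) := fun μ => by
    push_cast; rw [mul_assoc]; exact mul_le_mul_of_nonneg_left (hjhi μ) (by positivity)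
  have hD : 0 ≤ D1 thetaProf := D1_nonneg contDiff_thetaProf hasCompactSupport_thetaProf
  refine ⟨fun x y => ?_, fun x y hxy => ?_, fun x z y μ hz hy => ?_, fun x y μ hy hface => ?_⟩
  · -- antisymmetry
    show e / (n : ℕ) * _ = -(e / (n : ℕ) * _)
    rw [cubeFluct_antisymm]; ring
  · -- the bond size
    show |1 * (e / (n : ℕ) * cubeFluct (Box d ℓ k M) n K j (Ac 0) Ac x y)| ≤ _
    have hb := abs_cubeFluct_le hN hT hδ h17 n K j x y hxy
    rw [one_mul, abs_mul, abs_of_pos (by positivity : (0 : ℝ) < e / (n : ℕ))]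
    calc e / (n : ℕ) * |cubeFluct (Box d ℓ k M) n K j (Ac 0) Ac x y|
        ≤ e / (n : ℕ) * (((d : ℝ) + 1) * ((n : ℤ) * S : ℤ) * (creg * e ^ (β - 1) / (n : ℕ))) :=
          mul_le_mul_of_nonneg_left hb (by positivity)
      _ = ((d : ℝ) + 1) * S * creg * (e * e ^ (β - 1)) / (n : ℕ) := by
          push_cast; field_simp
      _ = ((d : ℝ) + 1) * S * creg * e ^ β / (n : ℕ) := by rw [mul_rpow_sub_one he]
  · -- the derivative member (both orientations are the same quantity)
    have hb := abs_cubeFluct_sub_le hN hT hδ h17 hn hK j hz hy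
    have key : |1 * (A' x z - A' z y)|
        ≤ creg * e ^ β * (1 + D1 thetaProf * (((d : ℝ) + 1) * S) / K) / ((n : ℕ) : ℝ) ^ 2 := by
      show |1 * (e / (n : ℕ) * cubeFluct (Box d ℓ k M) n K j (Ac 0) Ac x z
          - e / (n : ℕ) * cubeFluct (Box d ℓ k M) n K j (Ac 0) Ac z y)| ≤ _
      rw [one_mul, ← mul_sub, abs_mul, abs_of_pos (by positivity : (0 : ℝ) < e / (n : ℕ))]
      calc e / (n : ℕ) * |cubeFluct (Box d ℓ k M) n K j (Ac 0) Ac x z - cubeFluct (Box d ℓ k M) n K j (Ac 0) Ac z y|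
          ≤ e / (n : ℕ) * (creg * e ^ (β - 1) / (n : ℕ)
              * (1 + D1 thetaProf * (((d : ℝ) + 1) * ((n : ℤ) * S : ℤ)) / ((n : ℝ) * K))) :=
            mul_le_mul_of_nonneg_left hb (by positivity)
        _ = creg * (e * e ^ (β - 1)) * (1 + D1 thetaProf * (((d : ℝ) + 1) * S) / K) / ((n : ℕ) : ℝ) ^ 2 := by
            push_cast; field_simp
        _ = _ := by rw [mul_rpow_sub_one he]
    refine ⟨?_, key⟩
    have hrev : A' y z - A' z x = A' x z - A' z y := by
      show e / (n : ℕ) * _ - e / (n : ℕ) * _ = e / (n : ℕ) * _ - e / (n : ℕ) * _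
      rw [← mul_sub, ← mul_sub, cubeFluct_sub_rev]
    rw [hrev]
    exact key
  · -- vanishing at the faces
    have h0 := cubeFluct_eq_zero_of_face hn hK hnK hjlo hjhi' (Ac 0) Ac hy hface
    show e / (n : ℕ) * _ = 0 ∧ e / (n : ℕ) * _ = 0
    rw [h0.1, h0.2, mul_zero]
    exact ⟨rfl, rfl⟩

/-- **«FOR e SUFFICIENTLY SMALL»**: two non-negative multiples of `e^β` (`β > 0`) are below any `t > 0` for
`0 < e ≤ e₁ = (t/(max(C,C′) + 1))^{1/β}`. [cite: Balaban1983RegularityDecay, Theorem p. 573 «for e sufficiently small»] -/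
theorem cube_threshold {C C' t β : ℝ} (hC : 0 ≤ C) (ht : 0 < t) (hβ : 0 < β) :
    ∃ e₁ : ℝ, 0 < e₁ ∧ ∀ e : ℝ, 0 < e → e ≤ e₁ → C * e ^ β ≤ t ∧ C' * e ^ β ≤ t := by
  set Cm : ℝ := max C C' with hCm
  have hCm0 : 0 ≤ Cm := le_max_of_le_left hC
  set s : ℝ := t / (Cm + 1) with hs
  have hs0 : 0 < s := div_pos ht (by linarith)
  refine ⟨s ^ (1 / β), Real.rpow_pos_of_pos hs0 _, fun e he hle => ?_⟩
  have heβ : e ^ β ≤ s := by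
    have h1 : e ^ β ≤ (s ^ (1 / β)) ^ β := Real.rpow_le_rpow he.le hle hβ.le
    rwa [one_div, Real.rpow_inv_rpow hs0.le hβ.ne'] at h1
  have key : Cm * e ^ β ≤ t := by
    calc Cm * e ^ β ≤ Cm * s := mul_le_mul_of_nonneg_left heβ hCm0
      _ = t * (Cm / (Cm + 1)) := by rw [hs]; ring
      _ ≤ t * 1 := mul_le_mul_of_nonneg_left ((div_le_one (by linarith)).2 (by linarith)) ht.le
      _ = t := mul_one t
  have hpow : 0 ≤ e ^ β := (Real.rpow_pos_of_pos he β).le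
  exact ⟨(mul_le_mul_of_nonneg_right (le_max_left C C') hpow).trans key,
    (mul_le_mul_of_nonneg_right (le_max_right C C') hpow).trans key⟩

/-- **THE TWO SMALLNESS CONDITIONS OF THE PRINTED ROUTE FROM `θ, θ′ ≤ t`** (uniformly over the running coefficient
`a_k ∈ [¾a₋, a₊]`): with `γ = min(2, ¾a₋)/4`, `C₁ = ℓ₁²(d+1)(1 + a₊(d+1))`,
`B = 3(d+1)ℓ₁ + (d+1)ℓ₁² + a₊ℓ₁(d+1)(2 + ℓ₁(d+1))`, any `t ≤ 1`, `t ≤ γ/(C₁ + 1)`, `t ≤ 1/(2(d+2)cB + 1)` gives the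
(1.8)-type condition `ℓ₁²θ²(d+1)(1 + a_k(d+1)) ≤ min(2,a_k)/4` and the Neumann-series condition
`(d+2)c(⋯) ≤ ½` of `B4Lemma22CrossSup.lemma22_17_sup_box`. [cite: Balaban1983RegularityDecay, p. 581 «For e
sufficiently small the series is convergent»] -/
theorem smallness_of_le (d : ℕ) {ℓ₁ c amin aplus ak t θ θ' : ℝ} (hℓ₁ : 0 ≤ ℓ₁) (hc : 0 ≤ c) (ha : 0 < amin)
    (hak1 : 3 / 4 * amin ≤ ak) (hak2 : ak ≤ aplus) (hθ0 : 0 ≤ θ) (hθ : θ ≤ t) (hθ' : θ' ≤ t) (ht1 : t ≤ 1)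
    (htS1 : t ≤ min 2 (3 / 4 * amin) / 4 / (ℓ₁ ^ 2 * ((d : ℝ) + 1) * (1 + aplus * ((d : ℝ) + 1)) + 1))
    (htS2 : t ≤ 1 / (2 * (((d : ℝ) + 2) * c) * (3 * ((d : ℝ) + 1) * ℓ₁ + ((d : ℝ) + 1) * ℓ₁ ^ 2
      + aplus * (ℓ₁ * ((d : ℝ) + 1)) * (2 + ℓ₁ * ((d : ℝ) + 1))) + 1)) :
    ℓ₁ ^ 2 * θ ^ 2 * ((d : ℝ) + 1) * (1 + ak * ((d : ℝ) + 1)) ≤ min 2 ak / 4 ∧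
    ((d : ℝ) + 2) * c * (((d : ℝ) + 1) * ℓ₁ * (θ + θ') + ((d : ℝ) + 1) * ℓ₁ * θ
      + ((d : ℝ) + 1) * ℓ₁ ^ 2 * θ ^ 2 + ak * (ℓ₁ * (((d : ℝ) + 1) * θ) * (2 + ℓ₁ * (((d : ℝ) + 1) * θ))))
      ≤ 1 / 2 := by
  have hak0 : 0 ≤ ak := by linarith
  have hapl : 0 ≤ aplus := by linarith
  have ht0 : 0 ≤ t := hθ0.trans hθ
  have hθ1 : θ ≤ 1 := hθ.trans ht1
  have hθsq : θ ^ 2 ≤ t := by nlinarith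
  set γ : ℝ := min 2 (3 / 4 * amin) / 4 with hγ
  set C₁ : ℝ := ℓ₁ ^ 2 * ((d : ℝ) + 1) * (1 + aplus * ((d : ℝ) + 1)) with hC₁
  set B : ℝ := 3 * ((d : ℝ) + 1) * ℓ₁ + ((d : ℝ) + 1) * ℓ₁ ^ 2
      + aplus * (ℓ₁ * ((d : ℝ) + 1)) * (2 + ℓ₁ * ((d : ℝ) + 1)) with hB
  have hγ0 : 0 < γ := by rw [hγ]; exact div_pos (lt_min two_pos (by linarith)) four_pos
  have hC₁0 : 0 ≤ C₁ := by rw [hC₁]; positivity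
  have hB0 : 0 ≤ B := by rw [hB]; positivity
  constructor
  · -- (1.8)-type condition
    have h1 : ℓ₁ ^ 2 * θ ^ 2 * ((d : ℝ) + 1) * (1 + ak * ((d : ℝ) + 1)) ≤ C₁ * θ ^ 2 := by
      rw [hC₁]
      have : ak * ((d : ℝ) + 1) ≤ aplus * ((d : ℝ) + 1) := mul_le_mul_of_nonneg_right hak2 (by positivity)
      nlinarith [sq_nonneg ℓ₁, sq_nonneg θ, mul_nonneg (mul_nonneg (sq_nonneg ℓ₁) (sq_nonneg θ))
        (by positivity : (0 : ℝ) ≤ (d : ℝ) + 1)]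
    have h2 : C₁ * θ ^ 2 ≤ C₁ * t := mul_le_mul_of_nonneg_left hθsq hC₁0
    have h3 : C₁ * t ≤ γ := by
      calc C₁ * t ≤ C₁ * (γ / (C₁ + 1)) := mul_le_mul_of_nonneg_left htS1 hC₁0
        _ = γ * (C₁ / (C₁ + 1)) := by ring
        _ ≤ γ * 1 := mul_le_mul_of_nonneg_left ((div_le_one (by linarith)).2 (by linarith)) hγ0.le
        _ = γ := mul_one γ
    have h4 : γ ≤ min 2 ak / 4 := by
      rw [hγ]
      exact div_le_div_of_nonneg_right (min_le_min_left 2 hak1) (by norm_num)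
    linarith
  · -- Neumann-series condition
    have hd1 : (0 : ℝ) ≤ (d : ℝ) + 1 := by positivity
    have i1 : ((d : ℝ) + 1) * ℓ₁ * (θ + θ') ≤ ((d : ℝ) + 1) * ℓ₁ * (2 * t) :=
      mul_le_mul_of_nonneg_left (by linarith) (by positivity)
    have i2 : ((d : ℝ) + 1) * ℓ₁ * θ ≤ ((d : ℝ) + 1) * ℓ₁ * t := mul_le_mul_of_nonneg_left hθ (by positivity)
    have i3 : ((d : ℝ) + 1) * ℓ₁ ^ 2 * θ ^ 2 ≤ ((d : ℝ) + 1) * ℓ₁ ^ 2 * t :=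
      mul_le_mul_of_nonneg_left hθsq (by positivity)
    have i4 : ak * (ℓ₁ * (((d : ℝ) + 1) * θ) * (2 + ℓ₁ * (((d : ℝ) + 1) * θ)))
        ≤ aplus * (ℓ₁ * ((d : ℝ) + 1) * (2 + ℓ₁ * ((d : ℝ) + 1))) * t := by
      have j1 : ℓ₁ * (((d : ℝ) + 1) * θ) ≤ ℓ₁ * ((d : ℝ) + 1) * t := by
        rw [mul_assoc]; exact mul_le_mul_of_nonneg_left (mul_le_mul_of_nonneg_left hθ hd1) hℓ₁
      have j2 : 2 + ℓ₁ * (((d : ℝ) + 1) * θ) ≤ 2 + ℓ₁ * ((d : ℝ) + 1) := by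
        have : ((d : ℝ) + 1) * θ ≤ ((d : ℝ) + 1) * 1 := mul_le_mul_of_nonneg_left hθ1 hd1
        nlinarith
      have j0 : 0 ≤ ℓ₁ * (((d : ℝ) + 1) * θ) := by positivity
      calc ak * (ℓ₁ * (((d : ℝ) + 1) * θ) * (2 + ℓ₁ * (((d : ℝ) + 1) * θ)))
          ≤ aplus * (ℓ₁ * ((d : ℝ) + 1) * t * (2 + ℓ₁ * ((d : ℝ) + 1))) :=
            mul_le_mul hak2 (mul_le_mul j1 j2 (by positivity) (by positivity)) (by positivity) hapl
        _ = aplus * (ℓ₁ * ((d : ℝ) + 1) * (2 + ℓ₁ * ((d : ℝ) + 1))) * t := by ring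
    have hsum : ((d : ℝ) + 1) * ℓ₁ * (θ + θ') + ((d : ℝ) + 1) * ℓ₁ * θ
        + ((d : ℝ) + 1) * ℓ₁ ^ 2 * θ ^ 2 + ak * (ℓ₁ * (((d : ℝ) + 1) * θ) * (2 + ℓ₁ * (((d : ℝ) + 1) * θ)))
        ≤ B * t := by rw [hB]; linarith
    have hfin : ((d : ℝ) + 2) * c * (B * t) ≤ 1 / 2 := by
      have hA0 : 0 ≤ ((d : ℝ) + 2) * c * B := by positivity
      calc ((d : ℝ) + 2) * c * (B * t) = (((d : ℝ) + 2) * c * B) * t := by ring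
        _ ≤ (((d : ℝ) + 2) * c * B) * (1 / (2 * (((d : ℝ) + 2) * c) * B + 1)) :=
            mul_le_mul_of_nonneg_left htS2 hA0
        _ = (1 / 2) * ((2 * (((d : ℝ) + 2) * c) * B) / (2 * (((d : ℝ) + 2) * c) * B + 1)) := by ring
        _ ≤ (1 / 2) * 1 := mul_le_mul_of_nonneg_left ((div_le_one (by positivity)).2 (by linarith)) (by norm_num)
        _ = 1 / 2 := mul_one _
    exact (mul_le_mul_of_nonneg_left hsum (by positivity)).trans hfin

/-- the running coefficient on the window: `¾a₋ ≤ a_k ≤ a₊` for `L ≥ 2`, `k ≥ 1`, `a ∈ [a₋, a₊]`, from [B1] (2.15)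
«a_k ↘ a_∞ = a(1 − L^{−2})» (`B1.ainf_lt_aSeq`, `B1.aSeq_le`). [cite: Balaban1982Higgs1, (2.15) p.609] -/
theorem aSeq_window {ℓ k : ℕ} (hℓ : 1 ≤ ℓ) (hk : 1 ≤ k) {amin aplus a : ℝ} (ha : 0 < amin) (h1 : amin ≤ a)
    (h2 : a ≤ aplus) : 3 / 4 * amin ≤ B1.aSeq a ((ℓ : ℝ) + 1) k ∧ B1.aSeq a ((ℓ : ℝ) + 1) k ≤ aplus := by
  have ha' : 0 < a := lt_of_lt_of_le ha h1
  have hL : (1 : ℝ) < (ℓ : ℝ) + 1 := by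
    have : (1 : ℝ) ≤ (ℓ : ℝ) := by exact_mod_cast hℓ
    linarith
  have hL2 : (2 : ℝ) ≤ (ℓ : ℝ) + 1 := by
    have : (1 : ℝ) ≤ (ℓ : ℝ) := by exact_mod_cast hℓ
    linarith
  refine ⟨?_, (B1.aSeq_le ha' hL k hk).trans h2⟩
  have hlt := B1.ainf_lt_aSeq ha' hL k hk
  have hinv : (((ℓ : ℝ) + 1) ^ 2)⁻¹ ≤ 1 / 4 := by
    rw [one_div]
    exact inv_anti₀ (by norm_num) (by nlinarith)
  nlinarith

end Hyps

section Threshold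

/-- **«FOR e SUFFICIENTLY SMALL» AT THE CUBE CONFIGURATION** — the common threshold of the pay-off theorems of
`B4Eq220CubeField` (for the Lemma-2.2 constant `c` of the member at hand): for `0 < e ≤ e₁`, `θ(e) = (d+1)S·c·e^β ≤ 1`
and both smallness conditions of the lineage hold at `θ(e)`, `θ′(e) = c·e^β(1 + D1(θ)(d+1)S/K)`, for every `a_k` of
the window `[¾a₋, a₊]`. [cite: Balaban1983RegularityDecay, Theorem p. 573 «for e sufficiently small», p. 581] -/
theorem cubeField_threshold (d : ℕ) {ℓ₁ c amin aplus creg β : ℝ} (hℓ₁ : 0 ≤ ℓ₁) (hc : 0 ≤ c)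
    (ha : 0 < amin) (hcreg : 0 ≤ creg) (hβ : 0 < β) (S K : ℕ) :
    ∃ e₁ : ℝ, 0 < e₁ ∧ ∀ e : ℝ, 0 < e → e ≤ e₁ → ∀ ak : ℝ, 3 / 4 * amin ≤ ak → ak ≤ aplus →
      ((d : ℝ) + 1) * S * creg * e ^ β ≤ 1 ∧
      ℓ₁ ^ 2 * (((d : ℝ) + 1) * S * creg * e ^ β) ^ 2 * ((d : ℝ) + 1) * (1 + ak * ((d : ℝ) + 1)) ≤ min 2 ak / 4 ∧
      ((d : ℝ) + 2) * c * (((d : ℝ) + 1) * ℓ₁ * (((d : ℝ) + 1) * S * creg * e ^ β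
          + creg * e ^ β * (1 + D1 thetaProf * (((d : ℝ) + 1) * S) / K))
        + ((d : ℝ) + 1) * ℓ₁ * (((d : ℝ) + 1) * S * creg * e ^ β)
        + ((d : ℝ) + 1) * ℓ₁ ^ 2 * (((d : ℝ) + 1) * S * creg * e ^ β) ^ 2
        + ak * (ℓ₁ * (((d : ℝ) + 1) * (((d : ℝ) + 1) * S * creg * e ^ β))
          * (2 + ℓ₁ * (((d : ℝ) + 1) * (((d : ℝ) + 1) * S * creg * e ^ β))))) ≤ 1 / 2 := by
  have hD : 0 ≤ D1 thetaProf := D1_nonneg contDiff_thetaProf hasCompactSupport_thetaProf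
  set t : ℝ := min 1 (min (min 2 (3 / 4 * amin) / 4 / (ℓ₁ ^ 2 * ((d : ℝ) + 1) * (1 + aplus * ((d : ℝ) + 1)) + 1))
    (1 / (2 * (((d : ℝ) + 2) * c) * (3 * ((d : ℝ) + 1) * ℓ₁ + ((d : ℝ) + 1) * ℓ₁ ^ 2
      + aplus * (ℓ₁ * ((d : ℝ) + 1)) * (2 + ℓ₁ * ((d : ℝ) + 1))) + 1))) with ht_def
  by_cases hapl : aplus < 3 / 4 * amin
  · -- empty window: any threshold will do
    refine ⟨1, one_pos, fun e _ _ ak hak1 hak2 => absurd (hak1.trans hak2) (not_le.2 hapl)⟩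
  rw [not_lt] at hapl
  have hapl0 : 0 ≤ aplus := by linarith
  have ht0 : 0 < t := by
    rw [ht_def]
    refine lt_min one_pos (lt_min ?_ ?_)
    · exact div_pos (div_pos (lt_min two_pos (by linarith)) four_pos) (by positivity)
    · exact div_pos one_pos (by positivity)
  obtain ⟨e₁, he₁, hth⟩ := cube_threshold (C := ((d : ℝ) + 1) * S * creg)
    (C' := creg * (1 + D1 thetaProf * (((d : ℝ) + 1) * S) / K)) (by positivity) ht0 hβ
  refine ⟨e₁, he₁, fun e he hle ak hak1 hak2 => ?_⟩
  obtain ⟨hθt, hθ't⟩ := hth e he hle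
  have hθ0 : 0 ≤ ((d : ℝ) + 1) * S * creg * e ^ β := by
    have := (Real.rpow_pos_of_pos he β).le; positivity
  have ht1 : t ≤ 1 := by rw [ht_def]; exact min_le_left _ _
  have htS1 : t ≤ min 2 (3 / 4 * amin) / 4 / (ℓ₁ ^ 2 * ((d : ℝ) + 1) * (1 + aplus * ((d : ℝ) + 1)) + 1) := by
    rw [ht_def]; exact (min_le_right _ _).trans (min_le_left _ _)
  have htS2 : t ≤ 1 / (2 * (((d : ℝ) + 2) * c) * (3 * ((d : ℝ) + 1) * ℓ₁ + ((d : ℝ) + 1) * ℓ₁ ^ 2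
      + aplus * (ℓ₁ * ((d : ℝ) + 1)) * (2 + ℓ₁ * ((d : ℝ) + 1))) + 1) := by
    rw [ht_def]; exact (min_le_right _ _).trans (min_le_right _ _)
  have hθ'le : creg * e ^ β * (1 + D1 thetaProf * (((d : ℝ) + 1) * S) / K) ≤ t := by
    rw [mul_assoc, mul_comm (e ^ β), ← mul_assoc]; exact hθ't
  exact ⟨hθt.trans ht1, smallness_of_le d hℓ₁ hc ha hak1 hak2 hθ0 hθt hθ'le ht1 htS1 htS2⟩

end Threshold

end

end Literature.MathematicalPhysics.QuantumFieldTheory.Balaban1983to89.B4CubeFieldHyps22
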